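import Summits.Ventures.CertifiedManyBodySolver.Downfold.EmeryShapeWindowClosure
import Summits.Ventures.CertifiedManyBodySolver.Downfold.EmeryFermiScalePointsHg1201VirtualCorners
import HarnessLib

/-!
# THE ONE-BAND FERMI-SURFACE SHAPE `t′/t` OF THE WHOLE TYPED 3BE BOX `emeryBoxHg1201 (EmeryBoxesCuprates)` FROM TWO VIRTUAL CORNERS (two-ray rule + window closure, §B.86;
# router/EMERY-SHAPE-CORNERS.tsv)

Venture CertifiedManyBodySolver, cell `pub/hubbard-downfold` (stage S1; INFLATION-RULES-3to1-B §B.86 (i)), seat hubbard-downfold-mod-4 (technique B, g35); namespace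
`Summit.Ventures.CertifiedManyBodySolver.Downfold.Emery`. Everything PROVED (0 sorry). WHAT THIS IS NOT: a statement about HgBa₂CuO₄ (box #19, P = 0) — the typed box is SCREENING-GRADE (its file's
grade line); `U = 0` one-body kinematics of the σ model (object E = the EXACT `t–t′` shape of the σ Fermi surface, `EmeryFermiSurfaceShape`); no interaction, no `t″`.

For EVERY one-body row `(Δ, t_pd, t_pp, t_pp′) ∈ [7/5, 5/2] × [28/25, 33/25] × [16/25, 17/20] × [161/1000, 26/125]` eV and the fillings below, the one-band `t′/t` of the σ-model Fermi surface AT THAT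
ROW'S OWN FERMI ENERGY lies in the window of the table (device: `EmeryShapeTwoRayRule` + `EmeryShapeWindowClosure`, exactly as `EmeryBoxesLa214ShapeCorners`; virtual corners
`V_lo = (1.4, 1.12, 0.85, 0.2762)`, `V_hi = (2.5, 1.32, 0.64, 0.1212)`, t_pp′ outside the typed range by the factor b₂/b₁ = 1.328 — the explicit 3 → 1 inflation, zero iff the box is pure or of fixed
t_pp′/t_pp ratio; certificates `EmeryFermiScalePointsHg1201VirtualCorners`).

| filling | certified window for t′/t over the WHOLE box | V_lo ε_F bracket | V_hi ε_F bracket | lower closure | EMERY-FS-WINDOWS (g19 sub-box device) | object-E row of record [float] |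
|---|---|---|---|---|---|---|
| n_H = 1.125 (ν = 7/16) | **[-0.3814, -0.2541]** | [1.566, 1.581] eV | [1.6141, 1.6241] eV | antitone (dd ≥ 1.566 on the window): L = fsRatio(V_lo; e₂) | [-0.3717,-0.2486] (v114 t_pp′ [0.111,0.208], n_H band) | [-0.57,-0.46] |
| n_H = 1.16 (ν = 21/50) | **[-0.3807, -0.2543]** | [1.5222, 1.5372] eV | [1.5813, 1.5913] eV | antitone (dd ≥ 1.473 on the window): L = fsRatio(V_lo; e₂) | [-0.3717,-0.2486] (v114 t_pp′ [0.111,0.208], n_H band) | [-0.57,-0.46] |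

Sources: three-band model [HybertsenSchluterChristensen1989, Eq. (1)]; [AndersenEtAl1995, §6]; box rows as cited in the typed object's file.
-/

noncomputable section

namespace Summit.Ventures.CertifiedManyBodySolver.Downfold.Emery

open Real Set

/-- **n_H = 1.125 (ν = 7/16): for every row of the box the one-band Fermi-surface `t′/t` (object E, at the row's own Fermi energy) lies in `[-0.3814, -0.2541]`.** Lower closure: antitone; upper: monotone. [folklore] -/
theorem hg1201Box_fsRatio_nH1125 {Δ a b c : ℝ} (hΔ : Δ ∈ Icc ((7 : ℝ) / 5) ((5 : ℝ) / 2)) (ha : a ∈ Icc ((28 : ℝ) / 25) ((33 : ℝ) / 25)) (hb : b ∈ Icc ((16 : ℝ) / 25) ((17 : ℝ) / 20)) (hc : c ∈ Icc ((161 : ℝ) / 1000) ((26 : ℝ) / 125)) :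
    fsRatio Δ a b c (fermiEnergyOf Δ a b c ((7 : ℝ) / 16)) ∈ Icc ((-1907 : ℝ) / 5000) ((-2541 : ℝ) / 10000) := by
  have hV : ((26 : ℝ) / 125) * ((17 : ℝ) / 20) / ((16 : ℝ) / 25) = ((221 : ℝ) / 800) := by norm_num
  have hW : ((161 : ℝ) / 1000) * ((16 : ℝ) / 25) / ((17 : ℝ) / 20) = ((1288 : ℝ) / 10625) := by norm_num
  have hVlo := (fermiEnergyOf_of_pointBracketCheck virtPt_Hg1201Vlo_nH1125_br (by norm_num) (by norm_num) (by norm_num) (ν := (7/16 : ℝ)) (by push_cast; exact ⟨le_rfl, le_rfl⟩)).2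
  have hVhi := (fermiEnergyOf_of_pointBracketCheck virtPt_Hg1201Vhi_nH1125_br (by norm_num) (by norm_num) (by norm_num) (ν := (7/16 : ℝ)) (by push_cast; exact ⟨le_rfl, le_rfl⟩)).2
  have hAlo := (fermiEnergyOf_of_pointBracketCheck virtPt_Hg1201Alo_nH1125_br (by norm_num) (by norm_num) (by norm_num) (ν := (7/16 : ℝ)) (by push_cast; exact ⟨le_rfl, le_rfl⟩)).2
  have hTop := (fermiEnergyOf_of_pointBracketCheck virtPt_Hg1201H_nH1125_br (by norm_num) (by norm_num) (by norm_num) (ν := (7/16 : ℝ)) (by push_cast; exact ⟨le_rfl, le_rfl⟩)).2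
  push_cast at hVlo hVhi hAlo hTop
  norm_num at hVlo hVhi hAlo hTop
  refine fsRatio_fermiEnergyOf_mem_Icc_windowClosure (Δ₁ := ((7 : ℝ) / 5)) (Δ₂ := ((5 : ℝ) / 2)) (a₁ := ((28 : ℝ) / 25)) (a₂ := ((33 : ℝ) / 25)) (b₁ := ((16 : ℝ) / 25))
    (b₂ := ((17 : ℝ) / 20)) (c₁ := ((161 : ℝ) / 1000)) (c₂ := ((26 : ℝ) / 125)) (e₁ := ((783 : ℝ) / 500)) (e₂ := ((841 : ℝ) / 500)) (e₃ := 0) (e₄ := ((16241 : ℝ) / 10000)) (by norm_num) (by norm_num) (by norm_num) (by norm_num)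
    (by norm_num) hΔ ha hb hc (by norm_num) (by norm_num) ?_ ?_ ?_ (by norm_num) ?_ ?_ ?_ (by norm_num) ?_
  · -- regime at the box's Fermi-energy high corner: c₂ b₂ ε_F(Δ₁, a₂, b₂, c₁) ≤ a₁² b₁
    nlinarith [hTop.2]
  · rw [hV]; exact hVlo.1
  · exact hAlo.2
  · intro ε hε
    rw [hV]
    have hanti := (fsRatio_mem_Icc_on_window_of_dopingDisc_nonneg (Δ := ((7 : ℝ) / 5)) (a := ((28 : ℝ) / 25)) (b := ((17 : ℝ) / 20)) (c := ((221 : ℝ) / 800))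
      (p := ((783 : ℝ) / 500)) (q := ((841 : ℝ) / 500)) (by norm_num) (by norm_num) (by norm_num) (by norm_num) (by norm_num) (by norm_num) (by norm_num)
      (by norm_num [dopingDisc]) hε).1
    refine le_trans ?_ hanti
    norm_num [fsRatio, fsD, fsN]
  · exact (fermiEnergyOf_pos (by norm_num) (by norm_num) (by norm_num) (by norm_num) (by norm_num) (by norm_num)).le
  · rw [hW]; exact hVhi.2
  · intro ε hε
    rw [hW]
    have hmono := (fsRatio_mem_Icc_on_window_of_dopingDisc_nonpos (Δ := ((5 : ℝ) / 2)) (a := ((33 : ℝ) / 25)) (b := ((16 : ℝ) / 25)) (c := ((1288 : ℝ) / 10625))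
      (p := 0) (q := ((16241 : ℝ) / 10000)) (by norm_num) (by norm_num) (by norm_num) (by norm_num) (by norm_num) (by norm_num) (by norm_num)
      (by norm_num [dopingDisc]) hε).2
    refine le_trans hmono ?_
    norm_num [fsRatio, fsD, fsN]

/-- **n_H = 1.16 (ν = 21/50): for every row of the box the one-band Fermi-surface `t′/t` (object E, at the row's own Fermi energy) lies in `[-0.3807, -0.2543]`.** Lower closure: antitone; upper: monotone. [folklore] -/
theorem hg1201Box_fsRatio_nH116 {Δ a b c : ℝ} (hΔ : Δ ∈ Icc ((7 : ℝ) / 5) ((5 : ℝ) / 2)) (ha : a ∈ Icc ((28 : ℝ) / 25) ((33 : ℝ) / 25)) (hb : b ∈ Icc ((16 : ℝ) / 25) ((17 : ℝ) / 20)) (hc : c ∈ Icc ((161 : ℝ) / 1000) ((26 : ℝ) / 125)) :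
    fsRatio Δ a b c (fermiEnergyOf Δ a b c ((21 : ℝ) / 50)) ∈ Icc ((-3807 : ℝ) / 10000) ((-2543 : ℝ) / 10000) := by
  have hV : ((26 : ℝ) / 125) * ((17 : ℝ) / 20) / ((16 : ℝ) / 25) = ((221 : ℝ) / 800) := by norm_num
  have hW : ((161 : ℝ) / 1000) * ((16 : ℝ) / 25) / ((17 : ℝ) / 20) = ((1288 : ℝ) / 10625) := by norm_num
  have hVlo := (fermiEnergyOf_of_pointBracketCheck virtPt_Hg1201Vlo_nH116_br (by norm_num) (by norm_num) (by norm_num) (ν := (21/50 : ℝ)) (by push_cast; exact ⟨le_rfl, le_rfl⟩)).2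
  have hVhi := (fermiEnergyOf_of_pointBracketCheck virtPt_Hg1201Vhi_nH116_br (by norm_num) (by norm_num) (by norm_num) (ν := (21/50 : ℝ)) (by push_cast; exact ⟨le_rfl, le_rfl⟩)).2
  have hAlo := (fermiEnergyOf_of_pointBracketCheck virtPt_Hg1201Alo_nH116_br (by norm_num) (by norm_num) (by norm_num) (ν := (21/50 : ℝ)) (by push_cast; exact ⟨le_rfl, le_rfl⟩)).2
  have hTop := (fermiEnergyOf_of_pointBracketCheck virtPt_Hg1201H_nH116_br (by norm_num) (by norm_num) (by norm_num) (ν := (21/50 : ℝ)) (by push_cast; exact ⟨le_rfl, le_rfl⟩)).2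
  push_cast at hVlo hVhi hAlo hTop
  norm_num at hVlo hVhi hAlo hTop
  refine fsRatio_fermiEnergyOf_mem_Icc_windowClosure (Δ₁ := ((7 : ℝ) / 5)) (Δ₂ := ((5 : ℝ) / 2)) (a₁ := ((28 : ℝ) / 25)) (a₂ := ((33 : ℝ) / 25)) (b₁ := ((16 : ℝ) / 25))
    (b₂ := ((17 : ℝ) / 20)) (c₁ := ((161 : ℝ) / 1000)) (c₂ := ((26 : ℝ) / 125)) (e₁ := ((7611 : ℝ) / 5000)) (e₂ := ((16369 : ℝ) / 10000)) (e₃ := 0) (e₄ := ((15913 : ℝ) / 10000)) (by norm_num) (by norm_num) (by norm_num) (by norm_num)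
    (by norm_num) hΔ ha hb hc (by norm_num) (by norm_num) ?_ ?_ ?_ (by norm_num) ?_ ?_ ?_ (by norm_num) ?_
  · -- regime at the box's Fermi-energy high corner: c₂ b₂ ε_F(Δ₁, a₂, b₂, c₁) ≤ a₁² b₁
    nlinarith [hTop.2]
  · rw [hV]; exact hVlo.1
  · exact hAlo.2
  · intro ε hε
    rw [hV]
    have hanti := (fsRatio_mem_Icc_on_window_of_dopingDisc_nonneg (Δ := ((7 : ℝ) / 5)) (a := ((28 : ℝ) / 25)) (b := ((17 : ℝ) / 20)) (c := ((221 : ℝ) / 800))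
      (p := ((7611 : ℝ) / 5000)) (q := ((16369 : ℝ) / 10000)) (by norm_num) (by norm_num) (by norm_num) (by norm_num) (by norm_num) (by norm_num) (by norm_num)
      (by norm_num [dopingDisc]) hε).1
    refine le_trans ?_ hanti
    norm_num [fsRatio, fsD, fsN]
  · exact (fermiEnergyOf_pos (by norm_num) (by norm_num) (by norm_num) (by norm_num) (by norm_num) (by norm_num)).le
  · rw [hW]; exact hVhi.2
  · intro ε hε
    rw [hW]
    have hmono := (fsRatio_mem_Icc_on_window_of_dopingDisc_nonpos (Δ := ((5 : ℝ) / 2)) (a := ((33 : ℝ) / 25)) (b := ((16 : ℝ) / 25)) (c := ((1288 : ℝ) / 10625))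
      (p := 0) (q := ((15913 : ℝ) / 10000)) (by norm_num) (by norm_num) (by norm_num) (by norm_num) (by norm_num) (by norm_num) (by norm_num)
      (by norm_num [dopingDisc]) hε).2
    refine le_trans hmono ?_
    norm_num [fsRatio, fsD, fsN]

end Summit.Ventures.CertifiedManyBodySolver.Downfold.Emery
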